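import Summits.QuantumFields.YangMills.Theorems.AllWindowsColdBoxTiltCubicCap
import Summits.QuantumFields.YangMills.Theorems.AllWindowsColdBoxTiltDominatorsMoments
import Literature.NumberTheory.LFunctions.XiMomentConcentration
import HarnessLib

/-!
# LINE-17 «hypercontractive second-order tilt expansion» on crux `AllWindowsColdBox.BoxMidWindowsSU22` (stmt-QuantumFields-24003):
# all powers of the cubic part `V₃ = tiltCubicW` of the tilt are `γ`-integrable (half of the cubic-chaos input of `tiltMoments_of_cubic`)

The assembly `tiltMoments_of_cubic` (sibling file `…TiltMomentsOfCubic`) closes stub E from ONE package on `V₃ = tiltCubicW ρ₂ H β`: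
(i) the hypercontractive even-moment bound `∫ V₃^{2k} dγ ≤ (2k−1)^{3k}(K₁(2H+3)⁶/β)^k` (E(1)+E(3)+E(5), seat w5) and (ii) integrability of
all even powers under `γ = gaussD`.  This file proves (ii) unconditionally, for any representation `ρ` and `β ≥ 0`, from a polynomial
DOMINATOR on the whole space:

* `abs_tiltCubicW_le_dominators` : `|tiltCubicW ρ H β t| ≤ 2304·β·(Σ_e ‖a_e‖² + Σ_e ‖a_e‖⁴)` (`|T_ρ(s,b,c)| ≤ 2‖s‖‖b‖‖c‖ ≤ 2(Σ_legs‖a‖)³`,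
  `(Σ₄ x)³ ≤ 16 Σ x³`, `x³ ≤ x² + x⁴`, and the leg count `sum_touching_legs_le`);
* **`integrable_tiltCubicW_pow`** : `Integrable (fun t => tiltCubicW ρ H β t ^ n) (gaussD H (dimE ρ))` for every `n`
  (domination by `(2304β)ⁿ·2ⁿ·((Σ‖a‖²)ⁿ + (Σ‖a‖⁴)ⁿ)` — `(x+y)ⁿ ≤ 2ⁿ(xⁿ+yⁿ)` is the tree's `Literature.NumberTheory.LFunctions.add_pow_le_two_pow`
  — integrable by `…TiltDominatorsMoments`).

No definition; standard axioms.  HONEST LABEL: helper toward the OPEN registered stub E of one critic-PASSed line on the R2ξ″ RECORD-rung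
crux 24003; no stub by name, no crux, rung or summit; the Yang–Mills mass gap is NOT proved by this file.
-/

set_option autoImplicit false

noncomputable section

open MeasureTheory ProbabilityTheory Finset
open scoped Matrix Matrix.Norms.Frobenius
open Literature.MathematicalPhysics.QuantumLattice
open Literature.MathematicalPhysics.QuantumFieldTheory
open Literature.MathematicalPhysics.QuantumFieldTheory.LatticeMaxwell
open Summit.QuantumFields.YangMills.Theorems.WeakCouplingRates
open Summit.QuantumFields.YangMills.Theorems.ColdBoxAllGroups
open Summit.QuantumFields.YangMills.Theorems.FreeEnergyLogCoefficient

namespace Summit.QuantumFields.YangMills.Theorems.AllWindowsColdBoxBoxMidLine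

/-! ## A polynomial dominator of the cubic part of the tilt on the whole space -/

section Dominator

variable {N : ℕ} {G : Type*} [Group G] (ρ : G →* Matrix (Fin N) (Fin N) ℂ) {H : ℕ}

/-- `x³ ≤ x² + x⁴` (`x²·(x − 1/2)² ≥ 0`). -/
theorem pow_three_le_sq_add_pow_four (x : ℝ) : x ^ 3 ≤ x ^ 2 + x ^ 4 := by
  nlinarith [mul_nonneg (sq_nonneg x) (sq_nonneg (x - 1 / 2)), sq_nonneg x]

/-- One cubic term against the legs: `|T_ρ(s,b,c)| ≤ 2(x₁+x₂+x₃+x₄)³` when `‖s‖ ≤ x₁+x₂+x₃+x₄` and `‖b‖, ‖c‖` are among the `xᵢ ≥ 0`. -/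
theorem abs_chartCubic_le_cube {s b c : EuclideanSpace ℝ (Fin (dimE ρ))} {X : ℝ} (hs : ‖s‖ ≤ X) (hb : ‖b‖ ≤ X) (hc : ‖c‖ ≤ X) :
    |chartCubic ρ s b c| ≤ 2 * X ^ 3 := by
  have hX : 0 ≤ X := (norm_nonneg _).trans hb
  refine (abs_chartCubic_le ρ s b c).trans ?_
  have h1 : 2 * ‖s‖ * ‖b‖ * ‖c‖ ≤ 2 * X * X * X := by gcongr
  nlinarith

/-- `(x₁+x₂+x₃+x₄)³ ≤ 16(x₁³+x₂³+x₃³+x₄³)` for `xᵢ ≥ 0`. -/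
theorem add_four_pow_three_le {a b c d : ℝ} (ha : 0 ≤ a) (hb : 0 ≤ b) (hc : 0 ≤ c) (hd : 0 ≤ d) :
    (a + b + c + d) ^ 3 ≤ 16 * (a ^ 3 + b ^ 3 + c ^ 3 + d ^ 3) := by
  have h := pow_sum_le_card_mul_sum_pow (s := (Finset.univ : Finset (Fin 4))) (f := ![a, b, c, d])
    (fun i _ => by fin_cases i <;> simp [ha, hb, hc, hd]) 2
  simp [Fin.sum_univ_four, add_assoc] at h
  linarith

/-- Six cubic terms with a common bound: `|T₁ − T₂ − T₃ − T₄ − T₅ + T₆| ≤ 6B` if each `|Tᵢ| ≤ B`. -/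
theorem abs_six_terms_le {T₁ T₂ T₃ T₄ T₅ T₆ B : ℝ} (h₁ : |T₁| ≤ B) (h₂ : |T₂| ≤ B) (h₃ : |T₃| ≤ B) (h₄ : |T₄| ≤ B)
    (h₅ : |T₅| ≤ B) (h₆ : |T₆| ≤ B) : |T₁ - T₂ - T₃ - T₄ - T₅ + T₆| ≤ 6 * B := by
  rw [abs_le] at h₁ h₂ h₃ h₄ h₅ h₆ ⊢
  constructor <;> linarith

/-- **The cubic part of the tilt is dominated by the quadratic and quartic dominators on the whole space**:
`|tiltCubicW ρ H β t| ≤ 2304·β·(Σ_e ‖a_e‖² + Σ_e ‖a_e‖⁴)` (`β ≥ 0`, `a_e = unscaleTE H D β t e`). -/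
theorem abs_tiltCubicW_le_dominators {β : ℝ} (hβ : 0 ≤ β) (t : TSpaceD H (dimE ρ)) :
    |tiltCubicW ρ H β t| ≤ 2304 * β * (∑ e : ColdFreeIdx H, ‖unscaleTE H (dimE ρ) β t e‖ ^ 2 +
      ∑ e : ColdFreeIdx H, ‖unscaleTE H (dimE ρ) β t e‖ ^ 4) := by
  unfold tiltCubicW
  refine (Finset.abs_sum_le_sum_abs _ _).trans ?_
  set a := extZero (unscaleTE H (dimE ρ) β t) with ha
  -- per plaquette: `≤ 96·β·Σ_legs ‖a_leg‖³ ≤ 96·β·Σ_legs (‖a_leg‖² + ‖a_leg‖⁴)`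
  have hq : ∀ q : ZdPlaquette 4,
      |β * ((chartCubic ρ (circV a (q.1, q.2.1.1, q.2.1.2)) (a (q.1, q.2.1.1)) (a (q.1 + Pi.single q.2.1.1 1, q.2.1.2)) -
          chartCubic ρ (circV a (q.1, q.2.1.1, q.2.1.2)) (a (q.1, q.2.1.1)) (a (q.1 + Pi.single q.2.1.2 1, q.2.1.1)) -
          chartCubic ρ (circV a (q.1, q.2.1.1, q.2.1.2)) (a (q.1, q.2.1.1)) (a (q.1, q.2.1.2)) -
          chartCubic ρ (circV a (q.1, q.2.1.1, q.2.1.2)) (a (q.1 + Pi.single q.2.1.1 1, q.2.1.2)) (a (q.1 + Pi.single q.2.1.2 1, q.2.1.1)) -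
          chartCubic ρ (circV a (q.1, q.2.1.1, q.2.1.2)) (a (q.1 + Pi.single q.2.1.1 1, q.2.1.2)) (a (q.1, q.2.1.2)) +
          chartCubic ρ (circV a (q.1, q.2.1.1, q.2.1.2)) (a (q.1 + Pi.single q.2.1.2 1, q.2.1.1)) (a (q.1, q.2.1.2))) / 2)| ≤
      96 * β * ((‖a (q.1, q.2.1.1)‖ ^ 2 + ‖a (q.1, q.2.1.1)‖ ^ 4) +
        (‖a (q.1 + Pi.single q.2.1.1 1, q.2.1.2)‖ ^ 2 + ‖a (q.1 + Pi.single q.2.1.1 1, q.2.1.2)‖ ^ 4) +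
        (‖a (q.1 + Pi.single q.2.1.2 1, q.2.1.1)‖ ^ 2 + ‖a (q.1 + Pi.single q.2.1.2 1, q.2.1.1)‖ ^ 4) +
        (‖a (q.1, q.2.1.2)‖ ^ 2 + ‖a (q.1, q.2.1.2)‖ ^ 4)) := by
    intro q
    set x₁ := ‖a (q.1, q.2.1.1)‖
    set x₂ := ‖a (q.1 + Pi.single q.2.1.1 1, q.2.1.2)‖
    set x₃ := ‖a (q.1 + Pi.single q.2.1.2 1, q.2.1.1)‖
    set x₄ := ‖a (q.1, q.2.1.2)‖
    have h₁ : 0 ≤ x₁ := norm_nonneg _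
    have h₂ : 0 ≤ x₂ := norm_nonneg _
    have h₃ : 0 ≤ x₃ := norm_nonneg _
    have h₄ : 0 ≤ x₄ := norm_nonneg _
    have hs : ‖circV a (q.1, q.2.1.1, q.2.1.2)‖ ≤ x₁ + x₂ + x₃ + x₄ := by
      unfold circV
      calc _ ≤ ‖a (q.1, q.2.1.1) + a (q.1 + Pi.single q.2.1.1 1, q.2.1.2) - a (q.1 + Pi.single q.2.1.2 1, q.2.1.1)‖ + ‖a (q.1, q.2.1.2)‖ :=
            norm_sub_le _ _
        _ ≤ (‖a (q.1, q.2.1.1) + a (q.1 + Pi.single q.2.1.1 1, q.2.1.2)‖ + ‖a (q.1 + Pi.single q.2.1.2 1, q.2.1.1)‖) + ‖a (q.1, q.2.1.2)‖ := by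
            gcongr; exact norm_sub_le _ _
        _ ≤ ((‖a (q.1, q.2.1.1)‖ + ‖a (q.1 + Pi.single q.2.1.1 1, q.2.1.2)‖) + ‖a (q.1 + Pi.single q.2.1.2 1, q.2.1.1)‖) +
            ‖a (q.1, q.2.1.2)‖ := by gcongr; exact norm_add_le _ _
        _ = x₁ + x₂ + x₃ + x₄ := rfl
    have hb₁ : x₁ ≤ x₁ + x₂ + x₃ + x₄ := by linarith
    have hb₂ : x₂ ≤ x₁ + x₂ + x₃ + x₄ := by linarith
    have hb₃ : x₃ ≤ x₁ + x₂ + x₃ + x₄ := by linarith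
    have hb₄ : x₄ ≤ x₁ + x₂ + x₃ + x₄ := by linarith
    have hsix := abs_six_terms_le (abs_chartCubic_le_cube ρ hs hb₁ hb₂) (abs_chartCubic_le_cube ρ hs hb₁ hb₃)
      (abs_chartCubic_le_cube ρ hs hb₁ hb₄) (abs_chartCubic_le_cube ρ hs hb₂ hb₃) (abs_chartCubic_le_cube ρ hs hb₂ hb₄)
      (abs_chartCubic_le_cube ρ hs hb₃ hb₄)
    have hcube := add_four_pow_three_le h₁ h₂ h₃ h₄
    have p₁ := pow_three_le_sq_add_pow_four x₁
    have p₂ := pow_three_le_sq_add_pow_four x₂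
    have p₃ := pow_three_le_sq_add_pow_four x₃
    have p₄ := pow_three_le_sq_add_pow_four x₄
    have hX3 : (x₁ + x₂ + x₃ + x₄) ^ 3 ≤ 16 * ((x₁ ^ 2 + x₁ ^ 4) + (x₂ ^ 2 + x₂ ^ 4) + (x₃ ^ 2 + x₃ ^ 4) + (x₄ ^ 2 + x₄ ^ 4)) := by
      linarith
    rw [abs_mul, abs_div, abs_of_nonneg hβ, abs_two]
    have h6 : 0 ≤ 6 * β := by positivity
    calc β * (|_| / 2) ≤ β * (6 * (2 * (x₁ + x₂ + x₃ + x₄) ^ 3) / 2) := by gcongr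
      _ = 6 * β * (x₁ + x₂ + x₃ + x₄) ^ 3 := by ring
      _ ≤ 6 * β * (16 * ((x₁ ^ 2 + x₁ ^ 4) + (x₂ ^ 2 + x₂ ^ 4) + (x₃ ^ 2 + x₃ ^ 4) + (x₄ ^ 2 + x₄ ^ 4))) :=
          mul_le_mul_of_nonneg_left hX3 h6
      _ = _ := by ring
  refine (Finset.sum_le_sum fun q _ => hq q).trans ?_
  rw [← Finset.mul_sum]
  have hlegs := sum_touching_legs_le (unscaleTE H (dimE ρ) β t) (fun v : EuclideanSpace ℝ (Fin (dimE ρ)) => ‖v‖ ^ 2 + ‖v‖ ^ 4)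
    (by simp) (fun v => by positivity) (plaquettesTouching (AxialGauge.boxEdges 4 (2 * H + 1)))
  rw [ha]
  have h96 : 0 ≤ 96 * β := by positivity
  calc 96 * β * ∑ q ∈ plaquettesTouching (AxialGauge.boxEdges 4 (2 * H + 1)),
        ((‖extZero (unscaleTE H (dimE ρ) β t) (q.1, q.2.1.1)‖ ^ 2 + ‖extZero (unscaleTE H (dimE ρ) β t) (q.1, q.2.1.1)‖ ^ 4) +
        (‖extZero (unscaleTE H (dimE ρ) β t) (q.1 + Pi.single q.2.1.1 1, q.2.1.2)‖ ^ 2 +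
          ‖extZero (unscaleTE H (dimE ρ) β t) (q.1 + Pi.single q.2.1.1 1, q.2.1.2)‖ ^ 4) +
        (‖extZero (unscaleTE H (dimE ρ) β t) (q.1 + Pi.single q.2.1.2 1, q.2.1.1)‖ ^ 2 +
          ‖extZero (unscaleTE H (dimE ρ) β t) (q.1 + Pi.single q.2.1.2 1, q.2.1.1)‖ ^ 4) +
        (‖extZero (unscaleTE H (dimE ρ) β t) (q.1, q.2.1.2)‖ ^ 2 + ‖extZero (unscaleTE H (dimE ρ) β t) (q.1, q.2.1.2)‖ ^ 4))
      ≤ 96 * β * (24 * ∑ e : ColdFreeIdx H, (‖unscaleTE H (dimE ρ) β t e‖ ^ 2 + ‖unscaleTE H (dimE ρ) β t e‖ ^ 4)) :=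
        mul_le_mul_of_nonneg_left hlegs h96
    _ = 2304 * β * (∑ e : ColdFreeIdx H, ‖unscaleTE H (dimE ρ) β t e‖ ^ 2 + ∑ e : ColdFreeIdx H, ‖unscaleTE H (dimE ρ) β t e‖ ^ 4) := by
        rw [Finset.sum_add_distrib]; ring

/-- **All powers of the cubic part of the tilt are `γ`-integrable** (`β ≥ 0`): the second half of the cubic-chaos input of
`tiltMoments_of_cubic`. -/
theorem integrable_tiltCubicW_pow {β : ℝ} (hβ : 0 ≤ β) (n : ℕ) :
    Integrable (fun t : TSpaceD H (dimE ρ) => tiltCubicW ρ H β t ^ n) (gaussD H (dimE ρ)) := by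
  -- dominator `(2304β)^n · 2^n · ((Σ‖a‖²)^n + (Σ‖a‖⁴)^n)`
  have h2 := integrable_sum_norm_unscaleTE_sq_pow (H := H) (D := dimE ρ) hβ 1 n
  have h4 := integrable_sum_norm_unscaleTE_pow_four_pow (H := H) (D := dimE ρ) hβ 1 n
  simp only [one_mul] at h2 h4
  have hdom : Integrable (fun t : TSpaceD H (dimE ρ) => (2304 * β) ^ n * (2 ^ n *
      ((∑ e : ColdFreeIdx H, ‖unscaleTE H (dimE ρ) β t e‖ ^ 2) ^ n + (∑ e : ColdFreeIdx H, ‖unscaleTE H (dimE ρ) β t e‖ ^ 4) ^ n)))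
      (gaussD H (dimE ρ)) := ((h2.add h4).const_mul _).const_mul _
  refine Integrable.mono' hdom ((measurable_tiltCubicW ρ β).pow_const n).aestronglyMeasurable (ae_of_all _ fun t => ?_)
  rw [Real.norm_eq_abs, abs_pow]
  have hS2 : 0 ≤ ∑ e : ColdFreeIdx H, ‖unscaleTE H (dimE ρ) β t e‖ ^ 2 := Finset.sum_nonneg fun e _ => by positivity
  have hS4 : 0 ≤ ∑ e : ColdFreeIdx H, ‖unscaleTE H (dimE ρ) β t e‖ ^ 4 := Finset.sum_nonneg fun e _ => by positivity
  have h := abs_tiltCubicW_le_dominators ρ hβ t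
  calc |tiltCubicW ρ H β t| ^ n
      ≤ (2304 * β * (∑ e : ColdFreeIdx H, ‖unscaleTE H (dimE ρ) β t e‖ ^ 2 + ∑ e : ColdFreeIdx H, ‖unscaleTE H (dimE ρ) β t e‖ ^ 4)) ^ n :=
        pow_le_pow_left₀ (abs_nonneg _) h n
    _ = (2304 * β) ^ n * (∑ e : ColdFreeIdx H, ‖unscaleTE H (dimE ρ) β t e‖ ^ 2 + ∑ e : ColdFreeIdx H, ‖unscaleTE H (dimE ρ) β t e‖ ^ 4) ^ n :=
        mul_pow _ _ _
    _ ≤ (2304 * β) ^ n * (2 ^ n *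
        ((∑ e : ColdFreeIdx H, ‖unscaleTE H (dimE ρ) β t e‖ ^ 2) ^ n + (∑ e : ColdFreeIdx H, ‖unscaleTE H (dimE ρ) β t e‖ ^ 4) ^ n)) :=
        mul_le_mul_of_nonneg_left (Literature.NumberTheory.LFunctions.add_pow_le_two_pow hS2 hS4 n)
          (pow_nonneg (mul_nonneg (by norm_num) hβ) n)

end Dominator

end Summit.QuantumFields.YangMills.Theorems.AllWindowsColdBoxBoxMidLine

end
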